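import Literature.Topology.FourManifolds.SurfaceGroupNielsenCoreSides
import Literature.Topology.FourManifolds.SurfaceGroupNielsenCoreSeparation2
import Literature.Topology.FourManifolds.SurfaceGroupNielsenCoreNoDoublePoint
import Literature.GroupTheory.CombinatorialGroupTheory.BinaryProductParity
import HarnessLib

/-!
# Nielsen's theorem, pillar CORE: a double point at the portals of two symbols — shared lemmas

Topic `Literature/Topology/FourManifolds`.  Auxiliary layer for the cases of the case analysis
of a double point `a < b` on the closed path of a potential-minimal configuration
(Zieschang–Vogt–Coldewey, LNM 835, proof of Thm. 5.3.2 with Lemma 5.3.4, in the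
minimal-counterexample recasting) in which both cuts are PORTALS, `a` interior to the kernel of
an occurrence `k` and `b` interior to the kernel of a different occurrence `k'`:

* index facts: `k < k'` (`ppb_lt_of_portalAt`), no occurrence is a portal at both cuts
  (`ppb_sep`), the occurrences strictly between `k` and `k'` are exactly the inside ones
  (`ppb_inside_of_btwn`, `ppb_btwn_of_inside`), and by Claim (A) the partner of an inside
  non-portal occurrence lies again strictly between `k` and `k'` (`ppb_bar_btwn`) — the
  symbol-closedness of the blocks `[k, k')`, `[k + 1, k' + 1)` used in the endgame;
* the crossing edges of the fixation (`ppb_crossing_edge_cases`): since neither cut is a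
  junction, no cancelling edge crosses, and a crossing formal edge belongs to one of the two
  portal symbols, i.e. it is the formal edge at a slot `(k, q)` or at a slot `(k', q')`.

The two mixed cases (partner of `k` inside and partner of `k'` outside, and conversely) are
`SurfaceGroupNielsenCoreCasePPio.lean` and `SurfaceGroupNielsenCoreCasePPoi.lean`.

## References

* H. Zieschang, E. Vogt, H.-D. Coldewey, *Surfaces and Planar Discontinuous Groups*, LNM 835
  (1980), proof of Thm. 5.3.2 and Lemma 5.3.4. [ZieschangVogtColdewey1980]
-/

noncomputable section

namespace Literature.Topology.FourManifolds

open Literature.GroupTheory.CombinatorialGroupTheory CycFactors List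

namespace SurfaceGroup

namespace Config

variable {g : ℕ} {φ : surfaceGen g → SurfaceGroup g}

/-! ## A letter is determined by its inverse -/

/-- Two letters with equal inverse letters are equal. [folklore] -/
theorem ppb_letter_eq_of_inv_eq {β : Type*} {x y : β × Bool}
    (h : ((x.1, !x.2) : β × Bool) = (y.1, !y.2)) : x = y := by
  obtain ⟨x1, x2⟩ := x
  obtain ⟨y1, y2⟩ := y
  simp only [Prod.mk.injEq] at h
  obtain ⟨h1, h2⟩ := h
  subst h1
  cases x2 <;> cases y2 <;> simp_all

/-! ## Index facts for two portal occurrences -/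

/-- **The portal at `a` comes before the portal at `b`**: if `a < b`, `a` is interior to the
kernel of `k` and `b` interior to the kernel of `k' ≠ k`, then `k < k'`.
[cite: ZieschangVogtColdewey1980, proof of Thm. 5.3.2] -/
theorem ppb_lt_of_portalAt (κ : Config φ) {a b k k' : ℕ} (hab : a < b) (hPa : κ.PortalAt a k)
    (hPb : κ.PortalAt b k') (hne : k ≠ k') : k < k' := by
  by_contra h
  have hlt : k' < k := by omega
  have := κ.Kend_le_Kstart_of_lt hlt
  unfold PortalAt at hPa hPb
  omega

/-- Two different portal occurrences: no occurrence is a portal at both cuts. [folklore] -/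
theorem ppb_sep (κ : Config φ) {a b k k' : ℕ} (hPa : κ.PortalAt a k) (hPb : κ.PortalAt b k')
    (hne : k ≠ k') : ∀ j, ¬ (κ.PortalAt a j ∧ κ.PortalAt b j) := by
  rintro j ⟨h1, h2⟩
  exact hne ((κ.portalAt_unique hPa h1).trans (κ.portalAt_unique h2 hPb))

/-- **The occurrences strictly between the two portal occurrences are inside.**
[cite: ZieschangVogtColdewey1980, proof of Thm. 5.3.2] -/
theorem ppb_inside_of_btwn (κ : Config φ) {a b k k' j : ℕ} (hPa : κ.PortalAt a k)
    (hPb : κ.PortalAt b k') (h1 : k < j) (h2 : j < k') : κ.Inside a b j := by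
  have e1 := κ.Kend_le_Kstart_of_lt h1
  have e2 := κ.Kend_le_Kstart_of_lt h2
  unfold PortalAt at hPa hPb
  exact ⟨by omega, by omega⟩

/-- **Inside occurrences lie strictly between the two portal occurrences.**
[cite: ZieschangVogtColdewey1980, proof of Thm. 5.3.2] -/
theorem ppb_btwn_of_inside (κ : Config φ) {a b k k' j : ℕ} (hPa : κ.PortalAt a k)
    (hPb : κ.PortalAt b k') (h : κ.Inside a b j) : k < j ∧ j < k' := by
  obtain ⟨h1, h2⟩ := h
  unfold PortalAt at hPa hPb
  constructor
  · by_contra hle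
    have := κ.Kstart_mono (not_lt.1 hle)
    omega
  · by_contra hle
    have := κ.Kend_le_Kend (not_lt.1 hle)
    omega

/-- An outside occurrence does not lie strictly between the two portal occurrences (kernels of
a minimal configuration are non-empty). [folklore] -/
theorem ppb_not_btwn_of_outside (κ : Config φ) (hg : 1 ≤ g) (hI : Indecomposable φ)
    (hM : MarkedNontrivial φ) (hmin : κ.IsMin) {a b k k' j : ℕ} (hPa : κ.PortalAt a k)
    (hPb : κ.PortalAt b k') (h : κ.Outside a b j) : ¬ (k < j ∧ j < k') := fun hj =>
  κ.not_outside_of_inside hg hI hM hmin (κ.ppb_inside_of_btwn hPa hPb hj.1 hj.2) h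

section Min

variable (κ : Config φ) (hg : 1 ≤ g) (hI : Indecomposable φ) (hM : MarkedNontrivial φ)
  (hmin : κ.IsMin)
include hg hI hM hmin

/-- **Claim (A) between two portals**: for an occurrence `j` strictly between the portal
occurrences `k < k'` which is neither `k̄` nor `k̄'`, the partner `j̄` lies strictly between
`k` and `k'` too (both are inside). [cite: ZieschangVogtColdewey1980, proof of Thm. 5.3.2 and Lemma 5.3.4] -/
theorem ppb_bar_btwn {a b : ℕ}
    (hP2 : ∀ σ : ℕ × ℕ, IsKernelSlot κ.U σ → σ.1 < κ.w.length →
      ((a ≤ kpos κ.U σ ∧ kpos κ.U σ < b) ↔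
        (a ≤ kpos κ.U (chainEnd κ.U κ.bar σ) ∧ kpos κ.U (chainEnd κ.U κ.bar σ) < b)))
    {k k' j : ℕ} (hPa : κ.PortalAt a k) (hPb : κ.PortalAt b k') (hj : j < κ.w.length)
    (h1 : k < j) (h2 : j < k') (hjk : j ≠ κ.bar k) (hjk' : j ≠ κ.bar k') :
    k < κ.bar j ∧ κ.bar j < k' := by
  have hbb : κ.bar (κ.bar j) = j := κ.bar_bar hj
  have hin : κ.Inside a b j := κ.ppb_inside_of_btwn hPa hPb h1 h2
  have hj0 : j ≠ k := by omega
  have hj0' : j ≠ k' := by omega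
  have hna : ¬ κ.PortalAt a j := fun h => hj0 (κ.portalAt_unique h hPa)
  have hnb : ¬ κ.PortalAt b j := fun h => hj0' (κ.portalAt_unique h hPb)
  have hna' : ¬ κ.PortalAt a (κ.bar j) := fun h =>
    hjk (by rw [← hbb, κ.portalAt_unique h hPa])
  have hnb' : ¬ κ.PortalAt b (κ.bar j) := fun h =>
    hjk' (by rw [← hbb, κ.portalAt_unique h hPb])
  have hin' := (κ.inside_iff_inside_bar hg hI hM hmin hP2 hj hna hnb hna' hnb').1 hin
  exact κ.ppb_btwn_of_inside hPa hPb hin'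

/-- **The crossing edges of the fixation of a double point at two portals**: with `a` interior
to the kernel of `k` and `b` interior to the kernel of `k'` (no occurrence a portal at both),
every crossing edge of the partner graph is the formal edge at a slot of `k` or at a slot of
`k'` — no cancelling edge crosses (neither cut is a junction), and the formal edges of
non-portal symbols do not cross (Claim (A)). [cite: ZieschangVogtColdewey1980, Lemma 5.3.4] -/
theorem ppb_crossing_edge_cases {a b : ℕ} (hab : a < b) (hbℓ : b < (closedPath κ.U).length)
    (hP2 : ∀ σ : ℕ × ℕ, IsKernelSlot κ.U σ → σ.1 < κ.w.length →
      ((a ≤ kpos κ.U σ ∧ kpos κ.U σ < b) ↔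
        (a ≤ kpos κ.U (chainEnd κ.U κ.bar σ) ∧ kpos κ.U (chainEnd κ.U κ.bar σ) < b)))
    {k k' : ℕ} (hPa : κ.PortalAt a k) (hPb : κ.PortalAt b k')
    (hsep : ∀ j, ¬ (κ.PortalAt a j ∧ κ.PortalAt b j)) {s : ℕ × ℕ → Bool}
    (hs : ∀ σ, s σ = decide (κ.SideIn a b σ)) {ε : CycFactors.Edge} (hε : IsEdge κ.U κ.bar ε)
    (hc : IsCrossing s ε) :
    (∃ q, q < (fac κ.U k).length ∧ ε = fedge κ.U κ.bar (k, q)) ∨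
      (∃ q', q' < (fac κ.U k').length ∧ ε = fedge κ.U κ.bar (k', q')) := by
  have hbar := κ.isPairing_bar
  obtain ⟨σ', hσ', h' | ⟨hkσ', h'⟩⟩ := hε
  · subst h'
    have hfc : κ.FCross a b σ' := by
      rw [κ.fcross_iff_decide_ne, ← hs, ← hs]
      exact isCrossing_fedge.1 hc
    have hq : σ'.2 < (fac κ.U σ'.1).length := hσ'.2
    have hσ'w : σ'.1 < κ.w.length := by rw [← length_U]; exact hσ'.1
    have hbb : κ.bar (κ.bar σ'.1) = σ'.1 := κ.bar_bar hσ'w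
    have hlen : (fac κ.U (κ.bar σ'.1)).length = (fac κ.U σ'.1).length :=
      hbar.length_fac_bar hσ'.1
    have hcases := κ.exists_portalAt_of_fcross hg hI hM hmin hP2 hσ' hfc
    have hfe : fedge κ.U κ.bar σ' =
        fedge κ.U κ.bar (κ.bar σ'.1, (fac κ.U σ'.1).length - 1 - σ'.2) := by
      rw [← fedge_fpartner hbar hσ']
      rfl
    obtain ⟨j, q⟩ := σ'
    dsimp only at hq hσ'w hbb hlen hcases hfe
    rcases hcases with h | h | h | h
    · obtain rfl : j = k := κ.portalAt_unique h hPa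
      exact Or.inl ⟨q, hq, rfl⟩
    · obtain rfl : j = k' := κ.portalAt_unique h hPb
      exact Or.inr ⟨q, hq, rfl⟩
    · obtain rfl : κ.bar j = k := κ.portalAt_unique h hPa
      exact Or.inl ⟨(fac κ.U j).length - 1 - q, by rw [hlen]; omega, hfe⟩
    · obtain rfl : κ.bar j = k' := κ.portalAt_unique h hPb
      exact Or.inr ⟨(fac κ.U j).length - 1 - q, by rw [hlen]; omega, hfe⟩
  · subst h'
    exfalso
    have hcc' : κ.CCross a b σ' := by
      rw [κ.ccross_iff_decide_ne hσ' hkσ', ← hs, ← hs]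
      exact isCrossing_cedge.1 hc
    exact κ.not_ccross_of_not_isJunction hg hI hM hmin hab hbℓ hsep
      (κ.not_isJunction_of_portalAt hPa) (κ.not_isJunction_of_portalAt hPb) hσ' hcc'

end Min

end Config

end SurfaceGroup

end Literature.Topology.FourManifolds

end
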